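import Literature.AlgebraicGeometry.Motives.AbelianVarietyTranslation
import Literature.AlgebraicGeometry.Motives.AbelianVarietyTheoremOfCube
import Literature.AlgebraicGeometry.Motives.CartierDivisorCurveDegree
import HarnessLib

/-!
# The curve forms on `X(C)` and on `Hom(A, B)`: biadditivity from the cube, positivity from ampleness

Let `X` be an abelian variety over a field `K`, `L` a Cartier divisor on `X` and `C` an integral
proper `K`-scheme of dimension one (a curve). For a `C`-valued point `x ∈ X(C)` put
`N_L(x) = deg_C (x^* L)` (`AbelianVariety.degPt`; `CartierDivisor.degree` of
`Motives/CartierDivisorCurveDegree` applied to `CartierDivisor.classPullback`) and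
`B_L(x, y) = N(x y) - N(x) - N(y)` (`AbelianVariety.pairPt`). This file proves:

* **biadditivity** `B(x y, z) = B(x, z) + B(y, z)` (`pairPt_mul_left/right`) from the cubical
  structure `cubicalStructure_linEquiv X` (Görtz–Wedhorn II, Prop. 27.167, the theorem of the cube;
  in the tree a consequence of the named fact `theoremOfCube_linEquiv`, Thm. 24.73) by taking
  degrees of the eight-term relation (`degPt_cube`) — the degree being additive and an invariant of
  linear equivalence on the curve `C`; `N(1) = 0`, `B(1, y) = 0`, `B(x⁻¹, y) = -B(x, y)`;
* **symmetry**: for a symmetric divisor (`[-1]^*L ∼ L`), `N(x⁻¹) = N(x)` and hence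
  **`B(x, x) = 2 N(x)`** (`pairPt_self`): `N` is a quadratic form with polar form `B`;
* **positivity**: if every point of `X` lies in the non-vanishing locus of a section of `𝒪(L)`
  (e.g. `L` a suitable multiple of an ample divisor), then `N(x) ≥ 0`
  (`degPt_nonneg`: `x^*L ∼ x^*(L + div s)`, an honest pull-back of an effective divisor); if moreover
  the loci `X_s` are affine (which is what `CartierDivisor.IsAmple` provides for a multiple of an ample
  divisor, `IsAmple.exists_forall_mem_nonvanishing`) and `x` is not constant, then
  **`N(x) ≥ 1`** (`one_le_degPt`): the proper curve `C` cannot be mapped into the affine `X_s`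
  (`apply_eq_apply_of_forall_mem`: `Γ(C, 𝒪_C)` is a field, Mathlib `isField_of_universallyClosed`),
  so `x^*(L + div s)` has a zero at a closed point of `C` and positive degree;
* the transfer to homomorphisms: for abelian varieties `A`, `B`, a test morphism `c : C → A` and a
  divisor `L` on `B`, `curveForm L C c f = N_L(f ∘ c)` and the biadditive
  `curvePairing L c : Hom(A, B) →+ Hom(A, B) →+ ℤ` with `2 N(f) = B(f, f)` (`two_mul_curveForm`),
  `N ≥ 0` (`curveForm_nonneg`) and `N(f) ≥ 1` when `f ∘ c` is not constant (`one_le_curveForm`).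

These are the positive quadratic forms behind the finite generation of `Hom(A, B)` without
Poincaré's reducibility theorem (`NumberTheory/DiophantineGeometry/AVIsogenyTateHomPositivityProofs`):
`N_{c,L}(f)` is the degree on the curve `c(C)` of the class `f^*L`, i.e. the restriction to a curve of
the positivity `(D^{g-1} · f^*D) > 0` of Mumford, *Abelian Varieties*, §21, Thm. 1 / Milne 1986,
Thm. 17.3 (Rosati), and for elliptic curves the positive definite quadratic form `deg` of Silverman,
*The Arithmetic of Elliptic Curves*, III.6.3. No named facts; the cubical structure enters as the
hypothesis `hcube : X.cubicalStructure_linEquiv`.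

Mathlib searched (pin): `MonObj.comp_mul`, `MonObj.comp_one`, `GrpObj.comp_inv`, `Grp.Hom.hom_mul`,
`Mon.Hom.hom_mul`, `IsOpenImmersion.lift`, `Scheme.toSpecΓ_naturality`, `isField_of_universallyClosed`
(all used); no line bundles / theorem of the cube / degrees on curves in Mathlib.

## References

* U. Görtz, T. Wedhorn, *Algebraic Geometry II*, Springer Spektrum (2023): Prop. 27.167 (p. 877),
  Definition/Remark 27.185 (symmetric line bundles). [GortzWedhorn2023]
* D. Mumford, *Abelian Varieties*, TIFR/OUP (1970): §6, Cor. 2 of the theorem of the cube (the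
  quadraticity of `f ↦ f^*L`); §21, Thm. 1 (positivity of the Rosati involution). [MumfordAV1970]
* J. S. Milne, *Abelian Varieties*, in Cornell–Silverman (eds.), *Arithmetic Geometry* (1986):
  Thm. 17.3 (held: `book:cornellnd-arithmetic-geometry`, PDF p. 206). [Milne1986AbelianVarieties]
* J. H. Silverman, *The Arithmetic of Elliptic Curves*, 2nd ed. (2009): III.6.3. [SilvermanAEC2009]
-/

universe u

open CategoryTheory CategoryTheory.Limits AlgebraicGeometry MonoidalCategory CartesianMonoidalCategory
open TopologicalSpace Topology Order

noncomputable section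

namespace Literature.AlgebraicGeometry.Motives

open scoped MonObj

namespace AbelianVariety

/-! ### The degree of `x^* L` for a curve-valued point `x` -/

section DegPt

variable {K : Type u} [Field K] {X : AbelianVariety K} (L : CartierDivisor X.X.left)
  (C : SchemeOver K) [IsIntegral C.left] [IsProper C.hom]

/-- **`N_L(x) = deg_C (x^* L)`** for a divisor `L` on the abelian variety `X` and a point `x ∈ X(C)`
with values in an integral proper `K`-scheme `C` (a curve in the applications): the degree
(`CartierDivisor.degree`, `Motives/CartierDivisorCurveDegree`) of the pull-back of the class of `L`
along `x` (`CartierDivisor.classPullback`). This is the function `λ(x)` of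
`Motives/AbelianVarietyCubeBilinear` composed with `deg : Pic(C) → ℤ`; for `X = J` a Jacobian,
`C` the curve and `L = Θ` it is the classical "degree of the pulled back theta divisor". [folklore] -/
def degPt (x : C ⟶ X.X) : ℤ :=
  CartierDivisor.degree C (L.classPullback x.left)

/-- **The pairing `B_L(x, y) = N_L(x y) - N_L(x) - N_L(y)`**, i.e. `deg_C` of the class of Mumford's
`Λ(L) = m^*L - p₁^*L - p₂^*L` pulled back along `(x, y) : C → X × X` (Mumford, *Abelian Varieties*,
§6, Cor. 2 of the theorem of the cube, and §8; `Motives/AbelianVarietyCubeBilinear.Lam` with values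
in `ℤ` through `deg`). [folklore] -/
def pairPt (x y : C ⟶ X.X) : ℤ :=
  degPt L C (x * y) - degPt L C x - degPt L C y

variable {C}

/-- `N(x y) = N(x) + N(y) + B(x, y)` (definition of `B`). [folklore] -/
theorem degPt_mul (x y : C ⟶ X.X) : degPt L C (x * y) = degPt L C x + degPt L C y + pairPt L C x y := by
  unfold pairPt; ring

/-- `B` is symmetric (`X(C)` is commutative). [folklore] -/
theorem pairPt_comm (x y : C ⟶ X.X) : pairPt L C x y = pairPt L C y x := by
  unfold pairPt; rw [mul_comm]; ring

variable (hC : height (⊤ : ↥C.left) = 1)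
include hC

/-- Linearly equivalent divisors on `C` have the same degree, `dim C = 1` (restated). [folklore] -/
theorem degree_congr {D E : CartierDivisor C.left} (h : D.LinEquiv E) :
    CartierDivisor.degree C D = CartierDivisor.degree C E :=
  h.degree_eq hC

/-- `N(1) = 0`: the pull-back along the constant point is trivial. [folklore] -/
theorem degPt_one : degPt L C (1 : C ⟶ X.X) = 0 := by
  unfold degPt
  rw [degree_congr hC (CartierDivisor.classPullback_linEquiv_zero_of_const _
    (fun y y' => by rw [one_left_apply, one_left_apply]) L)]
  exact CartierDivisor.degree_zero

/-- **The theorem of the cube in degrees**: `N(xyz) + N(x) + N(y) + N(z) = N(xy) + N(xz) + N(yz)`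
for `x, y, z ∈ X(C)`, from the cubical structure `cubicalStructure_linEquiv X`
(Görtz–Wedhorn II, Prop. 27.167) by taking degrees. [cite: GortzWedhorn2023, Prop. 27.167 (p. 877)] -/
theorem degPt_cube (hcube : X.cubicalStructure_linEquiv) (x y z : C ⟶ X.X) :
    degPt L C (x * y * z) + degPt L C x + degPt L C y + degPt L C z =
      degPt L C (x * y) + degPt L C (x * z) + degPt L C (y * z) := by
  have h := degree_congr hC (hcube C x y z L)
  simp only [CartierDivisor.degree_add] at h
  have h1 : CartierDivisor.degree C (L.classPullback (1 : C ⟶ X.X).left) = 0 := degPt_one L hC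
  unfold degPt
  linarith

/-- **`B` is biadditive**: `B(x y, z) = B(x, z) + B(y, z)` (the cubical structure).
[cite: GortzWedhorn2023, Prop. 27.167 (p. 877)] -/
theorem pairPt_mul_left (hcube : X.cubicalStructure_linEquiv) (x y z : C ⟶ X.X) :
    pairPt L C (x * y) z = pairPt L C x z + pairPt L C y z := by
  have h := degPt_cube L hC hcube x y z
  unfold pairPt
  linarith

/-- `B(x, y z) = B(x, y) + B(x, z)`. [folklore] -/
theorem pairPt_mul_right (hcube : X.cubicalStructure_linEquiv) (x y z : C ⟶ X.X) :
    pairPt L C x (y * z) = pairPt L C x y + pairPt L C x z := by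
  rw [pairPt_comm, pairPt_mul_left L hC hcube, pairPt_comm L y, pairPt_comm L z]

/-- `B(1, y) = 0`. [folklore] -/
theorem pairPt_one_left (y : C ⟶ X.X) : pairPt L C 1 y = 0 := by
  unfold pairPt; rw [one_mul, degPt_one L hC]; ring

/-- `B(x⁻¹, y) = - B(x, y)`. [folklore] -/
theorem pairPt_inv_left (hcube : X.cubicalStructure_linEquiv) (x y : C ⟶ X.X) :
    pairPt L C x⁻¹ y = - pairPt L C x y := by
  have h := pairPt_mul_left L hC hcube x⁻¹ x y
  rw [inv_mul_cancel, pairPt_one_left L hC] at h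
  linarith

omit [IsIntegral C.left] [IsProper C.hom] hC in
/-- Inversion of `C`-points is composition with `[-1] = -𝟙 X`. [folklore] -/
theorem inv_eq_comp_neg_one (x : C ⟶ X.X) : x⁻¹ = x ≫ (-𝟙 X).hom.hom.hom := by
  rw [show (-𝟙 X).hom.hom.hom = X.zsmulPt (-1) by rw [zsmulPt, neg_one_zsmul],
    zsmulPt_neg_one_eq_inv, GrpObj.comp_inv, Category.comp_id]

/-- **`N(x⁻¹) = N(x)` for a symmetric divisor** `[-1]^*L ∼ L`. [folklore] -/
theorem degPt_inv (hsym : (L.pullback (Hom.toSchemeHom (-𝟙 X))).LinEquiv L) (x : C ⟶ X.X) :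
    degPt L C x⁻¹ = degPt L C x := by
  unfold degPt
  apply degree_congr hC
  rw [inv_eq_comp_neg_one, Over.comp_left]
  have e : (L.classPullback (x.left ≫ Hom.toSchemeHom (-𝟙 X))).LinEquiv
      ((L.classPullback (Hom.toSchemeHom (-𝟙 X))).classPullback x.left) :=
    L.classPullback_comp_linEquiv _ _
  exact e.trans (((L.classPullback_linEquiv_pullback (Hom.toSchemeHom (-𝟙 X))).trans hsym).classPullback
    x.left)

/-- **`B(x, x) = 2 N(x)`** for a symmetric divisor: `N` is the quadratic form of the symmetric
biadditive pairing `B` (up to the factor `2`). [folklore] -/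
theorem pairPt_self (hcube : X.cubicalStructure_linEquiv)
    (hsym : (L.pullback (Hom.toSchemeHom (-𝟙 X))).LinEquiv L) (x : C ⟶ X.X) :
    pairPt L C x x = 2 * degPt L C x := by
  have h1 := pairPt_inv_left L hC hcube x x
  have h2 : pairPt L C x⁻¹ x = degPt L C 1 - degPt L C x⁻¹ - degPt L C x := by
    unfold pairPt; rw [inv_mul_cancel]
  rw [degPt_one L hC, degPt_inv L hC hsym] at h2
  linarith

end DegPt

/-! ### Positivity: `N(x) ≥ 0`, and `N(x) ≥ 1` if `x` is not constant -/

section Positivity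

variable {K : Type u} [Field K] {X : AbelianVariety K} (L : CartierDivisor X.X.left)
  {C : SchemeOver K} [IsIntegral C.left] [IsProper C.hom] (hC : height (⊤ : ↥C.left) = 1)

/-! The **generation hypotheses** on `L` used for positivity are spelled out in each statement (they
are hypotheses, not named facts): "every point of `X` lies in the non-vanishing locus `X_s` of some
global section `s` of `𝒪_X(L)`" (`∀ b, ∃ s, L.IsSection s ∧ b ∈ L.nonvanishing s`), for `N ≥ 0`, and
the same with the `X_s` affine (`… ∧ IsAffineOpen (L.nonvanishingOpens s)`, which is what
`CartierDivisor.IsAmple` provides for a multiple `d • D` of an ample `D`), for `N ≥ 1`. -/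

variable {L}

/-- A multiple `d • D`, `d ≥ 1` as in the definition of ampleness, of an ample divisor is generated
by affine sections. [folklore] -/
theorem _root_.Literature.AlgebraicGeometry.Motives.CartierDivisor.IsAmple.exists_forall_mem_nonvanishing
    {D : CartierDivisor X.X.left} (hD : D.IsAmple) :
    ∃ d : ℕ, 0 < d ∧ ∀ b : ↥X.X.left, ∃ s : X.X.left.functionField,
      (d • D).IsSection s ∧ b ∈ (d • D).nonvanishing s ∧ IsAffineOpen ((d • D).nonvanishingOpens s) := by
  obtain ⟨_, _, d, hd, h⟩ := hD
  exact ⟨d, hd, fun b => h b⟩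

omit [IsIntegral C.left] [IsProper C.hom] in
/-- A section with a non-vanishing point is a nonzero rational function. [folklore] -/
theorem ne_zero_of_mem_nonvanishing {s : X.X.left.functionField} {b : ↥X.X.left}
    (hb : b ∈ L.nonvanishing s) : s ≠ 0 := by
  obtain ⟨i, -, hu⟩ := hb
  rintro rfl
  rw [mul_zero] at hu
  exact hu.ne_zero rfl

include hC in
/-- **`N(x) ≥ 0`**: `x^* L ∼ x^*(L + div s)` for a section `s` not vanishing at `x(η_C)`, and the
latter is the honest pull-back of an effective divisor, hence effective of degree `≥ 0`.
[folklore] -/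
theorem degPt_nonneg (hgen : ∀ b : ↥X.X.left, ∃ s : X.X.left.functionField, L.IsSection s ∧ b ∈ L.nonvanishing s)
    (x : C ⟶ X.X) : 0 ≤ degPt L C x := by
  obtain ⟨s, hs, hb⟩ := hgen (x.left (⊤ : ↥C.left))
  have hs0 : s ≠ 0 := ne_zero_of_mem_nonvanishing hb
  have hE : (L + CartierDivisor.principal s hs0).IsEffective :=
    ((CartierDivisor.isEffective_add_principal_iff (D := L) hs0).mpr hs)
  have hEb : (L + CartierDivisor.principal s hs0).Avoids (x.left (genericPoint C.left)) :=
    (L.avoids_add_principal_iff hs0).mpr hb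
  have hLE : L.LinEquiv (L + CartierDivisor.principal s hs0) := ⟨s, hs0, CartierDivisor.SameDivisor.refl _⟩
  unfold degPt
  rw [degree_congr hC ((hLE.classPullback x.left).trans
    ((L + CartierDivisor.principal s hs0).classPullback_linEquiv_pullbackAvoiding x.left hEb))]
  exact (hE.pullbackAvoiding x.left hEb).degree_nonneg

omit hC in
/-- **A proper integral `K`-scheme mapping into an affine open is mapped to a point.** If all values
of `x : C → X` lie in an affine open `V`, then `x` is constant: `Γ(C, 𝒪_C)` is a field (Mathlib
`isField_of_universallyClosed`), and a morphism from `C` to the affine scheme `V` factors through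
`C → Spec Γ(C, 𝒪_C)`, a point. [folklore] -/
theorem apply_eq_apply_of_forall_mem {V : X.X.left.Opens} (hV : IsAffineOpen V) (x : C ⟶ X.X)
    (hx : ∀ w : ↥C.left, x.left w ∈ V) (w w' : ↥C.left) : x.left w = x.left w' := by
  -- factor `x` through the affine open subscheme `V`
  have hrange : Set.range x.left.base ⊆ Set.range (V.ι).base := by
    rintro _ ⟨w, rfl⟩
    rw [Scheme.Opens.range_ι]
    exact hx w
  let x' : C.left ⟶ ↑V := IsOpenImmersion.lift V.ι x.left hrange
  have hx' : x' ≫ V.ι = x.left := IsOpenImmersion.lift_fac _ _ _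
  haveI : IsAffine (↑V : Scheme) := hV
  -- `Γ(C, 𝒪_C)` is a field, so `Spec Γ(C, 𝒪_C)` is a point
  haveI : UniversallyClosed C.hom := inferInstance
  have hfield := isField_of_universallyClosed K C.hom
  letI := hfield.toField
  haveI : Subsingleton ↥(Spec Γ(C.left, ⊤)) := inferInstanceAs (Subsingleton (PrimeSpectrum Γ(C.left, ⊤)))
  -- `x' ≫ toSpecΓ V = toSpecΓ C ≫ Spec (x'^*)`
  have hnat := Scheme.toSpecΓ_naturality x'
  have key : ∀ v : ↥C.left, (↑V : Scheme).toSpecΓ (x' v) =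
      (Spec.map x'.appTop) (C.left.toSpecΓ v) := fun v => by
    rw [← Scheme.Hom.comp_apply, ← Scheme.Hom.comp_apply, hnat]
  have h1 : (↑V : Scheme).toSpecΓ (x' w) = (↑V : Scheme).toSpecΓ (x' w') := by
    rw [key, key, Subsingleton.elim (C.left.toSpecΓ w) (C.left.toSpecΓ w')]
  have h2 : x' w = x' w' := (↑V : Scheme).toSpecΓ.isOpenEmbedding.injective h1
  rw [← hx', Scheme.Hom.comp_apply, Scheme.Hom.comp_apply, h2]

include hC in
/-- **`N(x) ≥ 1` if `x` is not constant** (for `L` generated by affine sections): with `s` a section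
not vanishing at `x(η_C)`, the image of the proper curve `C` is not inside the affine `X_s`
(`apply_eq_apply_of_forall_mem`), so the effective divisor `x^*(L + div s)` has a zero at some
closed point of `C` and positive degree. This is where properness of `C` and the affineness of the
`X_s` (ampleness) enter. [folklore] -/
theorem one_le_degPt (hgen : ∀ b : ↥X.X.left, ∃ s : X.X.left.functionField,
      L.IsSection s ∧ b ∈ L.nonvanishing s ∧ IsAffineOpen (L.nonvanishingOpens s))
    (x : C ⟶ X.X) {w₀ : ↥C.left}
    (hw₀ : x.left w₀ ≠ x.left ⊤) : 1 ≤ degPt L C x := by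
  obtain ⟨s, hs, hb, haff⟩ := hgen (x.left (⊤ : ↥C.left))
  have hs0 : s ≠ 0 := ne_zero_of_mem_nonvanishing hb
  set E := L + CartierDivisor.principal s hs0 with hEdef
  have hE : E.IsEffective := ((CartierDivisor.isEffective_add_principal_iff (D := L) hs0).mpr hs)
  have hEb : E.Avoids (x.left (genericPoint C.left)) := (L.avoids_add_principal_iff hs0).mpr hb
  have hLE : L.LinEquiv E := ⟨s, hs0, CartierDivisor.SameDivisor.refl _⟩
  -- some point `w` of `C` is mapped outside `X_s`
  obtain ⟨w, hw⟩ : ∃ w : ↥C.left, x.left w ∉ L.nonvanishing s := by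
    by_contra h
    simp only [not_exists, not_not] at h
    exact hw₀ (apply_eq_apply_of_forall_mem haff x h w₀ ⊤)
  -- `w` is a closed point (it is not the generic point, and `dim C = 1`)
  have hwtop : w ≠ ⊤ := by rintro rfl; exact hw hb
  have hw0 : height w = 0 := by
    have hlt : w < ⊤ := by
      refine lt_of_le_not_ge le_top fun h => hwtop ?_
      exact ((Scheme.le_iff_specializes.mp h).antisymm (Scheme.le_iff_specializes.mp le_top)).eq
    have h := Order.height_strictMono hlt ((Order.height_mono hlt.le).trans_lt (by rw [hC]; exact WithTop.coe_lt_top 1))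
    rw [hC] at h
    exact Order.lt_one_iff.mp h
  -- the chart of `L` at `x w` also contains `x η_C`
  obtain ⟨i, hi⟩ := L.covers (x.left w)
  have hitop : x.left (genericPoint C.left) ∈ L.U i :=
    (x.left.base.hom.map_specializes ((genericPoint_spec C.left).specializes (Set.mem_univ w))).mem_open
      (L.U i).2 hi
  have hu : ¬ RatFn.IsUnitAt (x.left w) (E.f (i, PUnit.unit)) := fun h =>
    hw ((L.mem_nonvanishing_iff hi).mpr h)
  unfold degPt
  rw [degree_congr hC ((hLE.classPullback x.left).trans (E.classPullback_linEquiv_pullbackAvoiding x.left hEb))]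
  refine ((hE.pullbackAvoiding x.left hEb).degree_pos hC (i := ⟨(i, PUnit.unit), hitop, trivial⟩)
    ⟨hi, trivial⟩ ?_ hw0)
  exact hE.not_isUnitAt_pullbackAvoiding x.left hEb ⟨(i, PUnit.unit), hitop, trivial⟩ ⟨hi, trivial⟩ hu

end Positivity

/-! ### The quadratic form on `Hom(A, B)` attached to a curve in `A` and a divisor on `B` -/

section HomForm

variable {K : Type u} [Field K] {A B : AbelianVariety K} (L : CartierDivisor B.X.left)
  (C : SchemeOver K) [IsIntegral C.left] [IsProper C.hom] (c : C ⟶ A.X)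

/-- The `C`-valued point `f ∘ c ∈ B(C)` of `B` defined by a homomorphism `f : A → B` and the test
morphism `c : C → A`. [folklore] -/
def curvePt (f : A ⟶ B) : C ⟶ B.X := c ≫ f.hom.hom.hom

omit [IsIntegral C.left] [IsProper C.hom] in
/-- `(f + g) ∘ c = (f ∘ c) · (g ∘ c)` in the group `B(C)`: addition of homomorphisms is pointwise.
[folklore] -/
theorem curvePt_add (f g : A ⟶ B) : curvePt C c (f + g) = curvePt C c f * curvePt C c g := by
  unfold curvePt
  rw [hom_add, Grp.Hom.hom_mul, Mon.Hom.hom_mul, MonObj.comp_mul]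

omit [IsIntegral C.left] [IsProper C.hom] in
/-- `0 ∘ c = 1`. [folklore] -/
theorem curvePt_zero : curvePt C c (0 : A ⟶ B) = 1 := by
  unfold curvePt
  rw [hom_zero, Grp.Hom.hom_one, Mon.Hom.hom_one, MonObj.comp_one]

omit [IsIntegral C.left] [IsProper C.hom] in
/-- `(-f) ∘ c = (f ∘ c)⁻¹`. [folklore] -/
theorem curvePt_neg (f : A ⟶ B) : curvePt C c (-f) = (curvePt C c f)⁻¹ := by
  apply eq_inv_of_mul_eq_one_left
  rw [← curvePt_add, neg_add_cancel, curvePt_zero]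

omit [IsIntegral C.left] [IsProper C.hom] in
/-- The underlying map of `f ∘ c` on points. [folklore] -/
theorem curvePt_left_apply (f : A ⟶ B) (w : ↥C.left) :
    (curvePt C c f).left w = (Hom.toSchemeHom f) (c.left w) := by
  unfold curvePt
  rw [Over.comp_left, Scheme.Hom.comp_apply]

/-- **The curve form `N_{c,L}(f) = deg_C ((f ∘ c)^* L)` on `Hom(A, B)`** attached to a test morphism
`c : C → A` from an integral proper curve and a divisor `L` on `B` — for `A = B = E` an elliptic
curve, `C = E`, `c = 𝟙`, `L = (O)` this is `deg f`, the positive definite quadratic form of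
Silverman, *The Arithmetic of Elliptic Curves*, III.6.3; in general it is the restriction to the curve
`c(C)` of the class `f^*L`, whose intersection number with an ample class is the positive form of
Mumford, *Abelian Varieties*, §21, Thm. 1 / Milne 1986, Thm. 17.3 (`Tr(f f†) ∼ (D^{g-1} · f^*D) > 0`).
[folklore] -/
def curveForm (f : A ⟶ B) : ℤ := degPt L C (curvePt C c f)

variable {C} (hC : height (⊤ : ↥C.left) = 1)

/-- **The biadditive pairing `B_{c,L}(f, g) = N(f + g) - N(f) - N(g)` on `Hom(A, B)`**, an
`AddMonoidHom` in each variable by the theorem of the cube (`pairPt_mul_left/right`). [folklore] -/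
def curvePairing (hcube : B.cubicalStructure_linEquiv) : (A ⟶ B) →+ (A ⟶ B) →+ ℤ :=
  AddMonoidHom.mk' (fun f => AddMonoidHom.mk' (fun g => pairPt L C (curvePt C c f) (curvePt C c g))
    (fun g g' => by rw [curvePt_add, pairPt_mul_right L hC hcube]))
    (fun f f' => by
      ext g
      simp only [AddMonoidHom.mk'_apply, AddMonoidHom.add_apply]
      rw [curvePt_add, pairPt_mul_left L hC hcube])

/-- Unfolding `curvePairing`. [folklore] -/
@[simp]
theorem curvePairing_apply (hcube : B.cubicalStructure_linEquiv) (f g : A ⟶ B) :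
    curvePairing L c hC hcube f g = pairPt L C (curvePt C c f) (curvePt C c g) := rfl

/-- `B(f, g) = N(f + g) - N(f) - N(g)`. [folklore] -/
theorem curvePairing_eq (hcube : B.cubicalStructure_linEquiv) (f g : A ⟶ B) :
    curvePairing L c hC hcube f g = curveForm L C c (f + g) - curveForm L C c f - curveForm L C c g := by
  rw [curvePairing_apply, pairPt, ← curvePt_add]; rfl

/-- `B` is symmetric. [folklore] -/
theorem curvePairing_comm (hcube : B.cubicalStructure_linEquiv) (f g : A ⟶ B) :
    curvePairing L c hC hcube f g = curvePairing L c hC hcube g f := by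
  rw [curvePairing_apply, curvePairing_apply, pairPt_comm]

/-- **`2 N(f) = B(f, f)`** for a symmetric divisor `L`: `N` is (half) the quadratic form of `B`.
[folklore] -/
theorem two_mul_curveForm (hcube : B.cubicalStructure_linEquiv)
    (hsym : (L.pullback (Hom.toSchemeHom (-𝟙 B))).LinEquiv L) (f : A ⟶ B) :
    2 * curveForm L C c f = curvePairing L c hC hcube f f := by
  rw [curvePairing_apply, pairPt_self L hC hcube hsym]; rfl

include hC in
/-- `N(0) = 0`. [folklore] -/
theorem curveForm_zero : curveForm L C c (0 : A ⟶ B) = 0 := by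
  unfold curveForm; rw [curvePt_zero]; exact degPt_one L hC

include hC in
/-- **`N(f) ≥ 0`** for `L` generated by sections. [folklore] -/
theorem curveForm_nonneg (hgen : ∀ b : ↥B.X.left, ∃ s : B.X.left.functionField, L.IsSection s ∧ b ∈ L.nonvanishing s)
    (f : A ⟶ B) : 0 ≤ curveForm L C c f :=
  degPt_nonneg hC hgen _

include hC in
/-- **`N(f) ≥ 1` if `f ∘ c` is not constant** (as a map on points), for `L` generated by affine
sections. [folklore] -/
theorem one_le_curveForm (hgen : ∀ b : ↥B.X.left, ∃ s : B.X.left.functionField,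
      L.IsSection s ∧ b ∈ L.nonvanishing s ∧ IsAffineOpen (L.nonvanishingOpens s))
    (f : A ⟶ B) {w₀ : ↥C.left}
    (hw₀ : (Hom.toSchemeHom f) (c.left w₀) ≠ (Hom.toSchemeHom f) (c.left ⊤)) :
    1 ≤ curveForm L C c f :=
  one_le_degPt hC hgen (curvePt C c f) (w₀ := w₀) (by rwa [curvePt_left_apply, curvePt_left_apply])

end HomForm

end AbelianVariety

end Literature.AlgebraicGeometry.Motives
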